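import Summits.ValiantsHypothesis.ValiantsHypothesis.Theorems.BarrierLeverAnchoredDoorHitsLowerPairsCofactorBasis
import Summits.ValiantsHypothesis.ValiantsHypothesis.Theorems.BarrierLeverAnchoredDoorHitsLowerPairsGapOne

/-!
# Support item `AnchoredDoorHitsLowerPairs` (stmt-ValiantsHypothesis-22510), line `anchored-peeling`:
# preliminaries for the general-gap face-target UQ step — cofactor families under ring maps, and the ROW WEIGHTS

Helper file (`--supports stmt-ValiantsHypothesis-22510`; cell valiant-natproofs, rung V4, 𝒟-side door (c); registered line
`Cruxes/AnchoredDoorHitsLowerPairs/Lines/anchored_peeling.lean` v13; prover seat val-np-p1 gen 20). Closes NO item.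

* `extRow_map`, `cofactorFamily_map`, `blockCofactorFamily_map` — the cofactor families of `…CofactorBasis` (p621668) commute with ring maps
  (used with `Polynomial.C`: the kernel vectors of the specialised layout are constants); `blockCofactorFamily_deleted` — value at a deleted row:
  `[d′ = d] · (−1)^n det K`; `vecMul_eq_zero_of_blockKept_transpose` — independence of the `p`-rows from a nonsingular kept block of the transpose.
* `uqWeight N cA hmax k = (hmax · Σ N + 1 + cA k) · ∏_{k′ ≠ k} N k′` — the integer weights of the one-variable specialisation of the sequel
  `…UQFaceCore`: with `N k ≥ 1`, `cA k ≤ hmax` one has `uqWeight t · N t < uqWeight k · N k` when `cA t < cA k` (`uqWeight_lt_of_lt`) and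
  `uqWeight t · e < uqWeight k · N k` when `e < N t` (`uqWeight_mul_lt`): row `k` of the cross matrix gets the private top degree `uqWeight k · N k`.

WHAT THIS IS NOT: no statement about the door; nothing on crux stmt-ValiantsHypothesis-14610 or on `VP` versus `VNP`.
-/

set_option linter.dupNamespace false

open Matrix

namespace Summit.ValiantsHypothesis.ValiantsHypothesis.Theorems.BarrierLever.AnchoredPeeling

noncomputable section

/-! ## 1. Cofactor families commute with ring maps -/

section MapLemmas

variable {A B : Type*} [CommRing A] [CommRing B] (f : A →+* B) {n : ℕ} {δ : Type*} [DecidableEq δ]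

/-- `extRow` commutes with ring maps. -/
theorem extRow_map (K : Matrix (Fin n) (Fin n) A) (v : Fin n → A) : extRow (K.map f) (f ∘ v) = (extRow K v).map f := by
  ext i j
  refine Fin.lastCases ?_ (fun i' => ?_) i
  · rw [extRow_last, Matrix.map_apply, extRow_last, Function.comp_apply]
  · rw [extRow_castSucc, Matrix.map_apply, Matrix.map_apply, extRow_castSucc]

/-- The cofactor family commutes with ring maps. -/
theorem cofactorFamily_map (K : Matrix (Fin n) (Fin n) A) (D : Matrix δ (Fin n) A) (d : δ) (t : Fin n ⊕ δ) :
    cofactorFamily (K.map f) (D.map f) d t = f (cofactorFamily K D d t) := by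
  have hext : extRow (K.map f) ((D.map f) d) = (extRow K (D d)).map f := by
    have : (D.map f) d = f ∘ D d := rfl
    rw [this, extRow_map]
  cases t with
  | inl i' => simp only [cofactorFamily, hext, rowCofactor_map]
  | inr d' =>
    simp only [cofactorFamily, hext]
    split_ifs
    · rw [rowCofactor_map]
    · rw [map_zero]

variable {m : Type*} [Fintype m] [DecidableEq m] (S : Matrix m m A) (S' : Matrix m m B) (p q : m → Prop) [DecidablePred p]
  [DecidablePred q] [Fintype δ] (e : {i : m // ¬ p i} ≃ Fin n ⊕ δ) (eQ : {j : m // q j} ≃ Fin n)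

omit [Fintype m] [DecidableEq m] [Fintype δ] [DecidablePred q] in
/-- The transported cofactor family commutes with ring maps (given that the tall block does). -/
theorem blockCofactorFamily_map (hS : ∀ i j, ¬ p i → q j → S' i j = f (S i j)) (d : δ) (i : m) :
    blockCofactorFamily S' p q e eQ d i = f (blockCofactorFamily S p q e eQ d i) := by
  by_cases hi : p i
  · rw [blockCofactorFamily_of_pos S' p q e eQ d hi, blockCofactorFamily_of_pos S p q e eQ d hi, map_zero]
  · have hK : blockKept S' p q e eQ = (blockKept S p q e eQ).map f :=
      Matrix.ext fun x y => hS _ _ (e.symm (Sum.inl x)).2 (eQ.symm y).2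
    have hD : blockDeleted S' p q e eQ = (blockDeleted S p q e eQ).map f :=
      Matrix.ext fun x y => hS _ _ (e.symm (Sum.inr x)).2 (eQ.symm y).2
    rw [blockCofactorFamily_of_neg S' p q e eQ d hi, blockCofactorFamily_of_neg S p q e eQ d hi, hK, hD, cofactorFamily_map]

omit [Fintype m] [DecidableEq m] [Fintype δ] [DecidablePred q] in
/-- Value of the transported cofactor family at a deleted row: `[d' = d] · (−1)^n det K`. -/
theorem blockCofactorFamily_deleted (d d' : δ) :
    blockCofactorFamily S p q e eQ d (e.symm (Sum.inr d')).1 = if d' = d then (-1) ^ n * (blockKept S p q e eQ).det else 0 := by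
  rw [blockCofactorFamily_of_neg S p q e eQ d (e.symm (Sum.inr d')).2]
  have : e ⟨(e.symm (Sum.inr d')).1, (e.symm (Sum.inr d')).2⟩ = Sum.inr d' := by simp
  rw [this]
  split_ifs with hd
  · rw [hd, cofactorFamily_inr_self]
  · rw [cofactorFamily_inr_ne _ _ hd]

end MapLemmas

/-! ## 2. Weights -/

section Weights

variable {κ : Type*} [Fintype κ] [DecidableEq κ] (N : κ → ℕ) (cA : κ → ℕ) (hmax : ℕ)

/-- The weight of index `k`: `(Λ + |A_k|) · ∏_{k' ≠ k} N_{k'}` with `Λ = hmax · Σ N + 1`. -/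
def uqWeight (k : κ) : ℕ := (hmax * (∑ k', N k') + 1 + cA k) * ∏ k' ∈ Finset.univ.erase k, N k'

variable {N cA hmax}

/-- `wt k · N k = (Λ + |A_k|) · ∏ N`. -/
theorem uqWeight_mul (hN : ∀ k, 1 ≤ N k) (k : κ) :
    uqWeight N cA hmax k * N k = (hmax * (∑ k', N k') + 1 + cA k) * ∏ k', N k' := by
  have _ := hN
  rw [uqWeight, mul_assoc, Finset.prod_erase_mul _ _ (Finset.mem_univ k)]

/-- Strictly smaller faces have strictly smaller top degrees. -/
theorem uqWeight_lt_of_lt (hN : ∀ k, 1 ≤ N k) {t k : κ} (hlt : cA t < cA k) :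
    uqWeight N cA hmax t * N t < uqWeight N cA hmax k * N k := by
  rw [uqWeight_mul hN, uqWeight_mul hN]
  have hPi : 0 < ∏ k', N k' := Finset.prod_pos (fun k' _ => hN k')
  exact Nat.mul_lt_mul_of_lt_of_le (by omega) le_rfl hPi

/-- Partial twist sets lose a full weight: `wt t · e < wt k · N k` whenever `e < N t` (and `|A_t| ≤ hmax`). -/
theorem uqWeight_mul_lt (hN : ∀ k, 1 ≤ N k) (hcA : ∀ k, cA k ≤ hmax) {t : κ} (k : κ) {e : ℕ} (he : e < N t) :
    uqWeight N cA hmax t * e < uqWeight N cA hmax k * N k := by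
  have hPi' : 0 < ∏ k' ∈ Finset.univ.erase t, N k' := Finset.prod_pos (fun k' _ => hN k')
  have h1 : uqWeight N cA hmax t * e + uqWeight N cA hmax t ≤ uqWeight N cA hmax t * N t := by
    rw [← Nat.mul_succ]; exact Nat.mul_le_mul_left _ (Nat.succ_le_of_lt he)
  have h2 : uqWeight N cA hmax t * N t = (hmax * (∑ k', N k') + 1) * (∏ k', N k') + cA t * ∏ k', N k' := by
    rw [uqWeight_mul hN, add_mul]
  have h3 : (hmax * (∑ k', N k') + 1) * (∏ k', N k') ≤ uqWeight N cA hmax k * N k := by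
    rw [uqWeight_mul hN]; exact Nat.mul_le_mul_right _ (Nat.le_add_right _ _)
  have h4 : cA t * ∏ k', N k' < uqWeight N cA hmax t := by
    rw [uqWeight, ← Finset.mul_prod_erase _ _ (Finset.mem_univ t), ← mul_assoc]
    refine Nat.mul_lt_mul_of_lt_of_le ?_ le_rfl hPi'
    have hNt : N t ≤ ∑ k', N k' := Finset.single_le_sum (fun k' _ => Nat.zero_le (N k')) (Finset.mem_univ t)
    calc cA t * N t ≤ hmax * N t := Nat.mul_le_mul_right _ (hcA t)
      _ ≤ hmax * ∑ k', N k' := Nat.mul_le_mul_left _ hNt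
      _ < hmax * (∑ k', N k') + 1 + cA t := by omega
  omega

/-- Top degrees are positive. -/
theorem uqWeight_mul_pos (hN : ∀ k, 1 ≤ N k) (k : κ) : 0 < uqWeight N cA hmax k * N k := by
  rw [uqWeight_mul hN]
  exact Nat.mul_pos (by omega) (Finset.prod_pos (fun k' _ => hN k'))

end Weights

/-! ## 3. Independence of the `p`-rows from the transpose's kept block -/

section Indep

variable {A : Type*} [CommRing A] [IsDomain A] {m : Type*} [Fintype m] [DecidableEq m] (S : Matrix m m A) (p q : m → Prop)
  [DecidablePred p] [DecidablePred q] {n' : ℕ} {δ : Type*} [Fintype δ] [DecidableEq δ]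
  (e' : {j : m // ¬ q j} ≃ Fin n' ⊕ δ) (eP : {i : m // p i} ≃ Fin n')

omit [DecidableEq m] [DecidablePred p] [DecidablePred q] [Fintype δ] [DecidableEq δ] in
/-- If the kept block of the transpose (kept `qᶜ`-columns against the `p`-rows) is nonsingular, the `p`-rows of `S` are linearly independent. -/
theorem vecMul_eq_zero_of_blockKept_transpose (hK : (blockKept S.transpose q p e' eP).det ≠ 0) (z : m → A)
    (hz : ∀ i, ¬ p i → z i = 0) (hzS : z ᵥ* S = 0) : z = 0 := by
  classical
  have hz' : (fun y => z (eP.symm y).1) ᵥ* (blockKept S.transpose q p e' eP).transpose = 0 := by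
    funext x
    rw [Pi.zero_apply]
    have hx := congrFun hzS (e'.symm (Sum.inl x)).1
    rw [Pi.zero_apply] at hx
    change ∑ i, z i * S i (e'.symm (Sum.inl x)).1 = 0 at hx
    rw [← Fintype.sum_subtype_add_sum_subtype p, Fintype.sum_eq_zero
      (fun i : {i : m // ¬ p i} => z i.1 * S i.1 (e'.symm (Sum.inl x)).1) (fun i => by rw [hz i.1 i.2, zero_mul]),
      add_zero, ← eP.symm.sum_comp] at hx
    exact hx
  have hdetT : (blockKept S.transpose q p e' eP).transpose.det ≠ 0 := by rwa [Matrix.det_transpose]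
  have hz0 := Matrix.eq_zero_of_vecMul_eq_zero hdetT hz'
  funext i
  by_cases hi : p i
  · have := congrFun hz0 (eP ⟨i, hi⟩)
    simpa using this
  · exact hz i hi

end Indep

end

end Summit.ValiantsHypothesis.ValiantsHypothesis.Theorems.BarrierLever.AnchoredPeeling
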